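import Literature.NumberTheory.DiophantineGeometry.OptimizedHeightBoundsModularity
import Literature.NumberTheory.DiophantineGeometry.SUnitAbcBoundsCongruenceNumber
import Literature.NumberTheory.EllipticCurves.HeightConductorBoundsModularityProofs
import Mathlib.Analysis.Complex.ExponentialBounds
import HarnessLib

/-!
# von Känel–Matschke §10: the printed deductions Prop. 10.6 ⟹ Prop. 10.2 (second display) and
# Prop. 10.8 (ii) ⟹ `Ω_opt ≤ Ω_sim` (proofs)

Topic `Literature/NumberTheory/DiophantineGeometry` (family `abc`, LADDER-ABC A1: the *modular method*).
Theorems only — NO new statement (D-0026); the `Proofs` companion of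
`SUnitMordellHeightBoundsModularity.lean` / `OptimizedHeightBoundsModularity.lean` (von Känel–Matschke,
arXiv:1605.06079 = Mem. AMS **286** (2023) no. 1419 [`VonkanelMatschke2023`], §10, arXiv numbering).

* `sUnitEquation_height_le_two_of_abc_log_max_le_refined` — **Prop. 10.6 ⟹ the SECOND display of
  Prop. 10.2**, `max(h(x), h(y)) ≤ (12/5) N_S log N_S + (9/10) N_S log log log(16 N_S) + 8.26 N_S + 28`
  for every solution of the `S`-unit equation, by the printed translation "there exists a solution
  `(a, b, c)` of (eq:abc) with `(x, y) = (a/c, b/c)`, the number `max(h(x), h(y))` equals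
  `log max(|a|, |b|, |c|)` and thus Proposition 10.6 implies Proposition 10.2" (§10.4): the row
  `(𝔢, λ) = (4, 12)` of (eq:refinedcondbound) gives exactly `(12/5) log 16 + 8/5 = 8.254… ≤ 8.26`, and
  the other three rows are dominated (the triple logarithm being monotone where it is positive).
* **Finding (recorded, not a kernel statement).** The FIRST display of Prop. 10.2,
  `max(h(x), h(y)) ≤ (5/2) N_S log N_S + 9 N_S`, is NOT a formal consequence of Prop. 10.6 for small `N_S`:
  the row `(4, 12)` carries the additive constant `28 > (5/2)·2·log 2 + 18` at `N_S = 2`, and numerically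
  `row(4,12) > (5/2) N_S log N_S + 9 N_S` exactly for the eleven square-free even values
  `N_S ∈ {2, 6, 10, 14, 22, 26, 30, 34, 38, 42, 46}` (i.e. `S = {2}, {2,3}, {2,5}, {2,7}, {2,11}, {2,13},
  {2,3,5}, {2,17}, {2,19}, {2,3,7}, {2,23}`); for these the printed sentence "Proposition 10.6 implies
  Proposition 10.2" relies implicitly on the known solution lists (vKM Part I). The named fact
  `sUnitEquation_height_le` (both displays) is therefore NOT derived here from `abc_log_max_le_refined`.
* `omegaOpt_le_omegaSim_of_prop_10_8_ii` — **`Ω_opt ≤ Ω_sim` ⟸ Prop. 10.8 (ii)** (§8.2/§9 with the proof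
  of Prop. 10.1 in §10.3: `α ≤ β ≤ (1/6)ν log N + (1/16)ν log₃ N + (1/9)ν` at `N = a_S ≥ 1728`,
  `ν(a_S) ≤ (2/3) a_S` since `4 · 9 ∣ a_S`, and `2 log(α(a_S) + κ) + 35 + 4κ ≤ (14/135) a_S`): the named
  fact `omegaOpt_le_omegaSim` follows from `vonKanelMatschke_prop_10_8_ii`; hence Prop. 10.1
  (`mordell_height_le`) follows from Prop. 10.7 and Prop. 10.8 (ii)
  (`mordell_height_le_of_proposition_10_7_of_prop_10_8_ii`).

No `abc` claim; typed ≠ proved: Prop. 10.6, Prop. 10.7, Prop. 10.8 (ii) remain named facts.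

## References

* [VonkanelMatschke2023] R. von Känel, B. Matschke, arXiv:1605.06079 = Mem. AMS 286 (2023), §10.1
  (Props. 10.1, 10.2), §10.3 (proof of Prop. 10.1, (eq:nuineq)), §10.4 (Prop. 10.6, proof of Prop. 10.2),
  §10.5.1 (Prop. 10.7, `α`, `κ`), §8.2/§9 (`Ω_opt ≤ Ω_sim`).
-/

noncomputable section

open Height
open Literature.NumberTheory.EllipticCurves.ModularForms

namespace Literature.NumberTheory.DiophantineGeometry

namespace VonKanelMatschke

/-! ### Real-analysis helpers for the (junk-valued) triple logarithm -/

/-- `log log log x ≥ 0` for `x ≥ 32` (`log 32 = 5 log 2 > e`). [folklore] -/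
private theorem logloglog_nonneg_of_le {x : ℝ} (hx : 32 ≤ x) :
    0 ≤ Real.log (Real.log (Real.log x)) := by
  have hl2 := Real.log_two_gt_d9
  have he := Real.exp_one_lt_d9
  have h32 : Real.log 32 = 5 * Real.log 2 := by
    rw [show (32 : ℝ) = 2 ^ 5 by norm_num, Real.log_pow]; push_cast; ring
  have h1 : Real.exp 1 ≤ Real.log x := by
    have := Real.log_le_log (by norm_num) hx
    linarith
  have h2 : 1 ≤ Real.log (Real.log x) := by
    have := Real.log_le_log (Real.exp_pos 1) h1
    rwa [Real.log_exp] at this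
  exact Real.log_nonneg h2

/-- Monotonicity of the triple logarithm where it is positive: for `2 ≤ y ≤ z` with `log₃ y > 0`,
`log₃ y ≤ log₃ z`. [folklore] -/
private theorem logloglog_mono {y z : ℝ} (hy : 2 ≤ y) (hyz : y ≤ z)
    (hpos : 0 < Real.log (Real.log (Real.log y))) :
    Real.log (Real.log (Real.log y)) ≤ Real.log (Real.log (Real.log z)) := by
  have hl2 := Real.log_two_gt_d9
  have he := Real.exp_one_gt_d9
  have hL1 : Real.log 2 ≤ Real.log y := Real.log_le_log (by norm_num) hy
  have hL1pos : 0 < Real.log y := by linarith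
  have hm1 : -1 ≤ Real.log (Real.log y) := by
    have h1 : Real.exp (-1) ≤ Real.log 2 := by
      rw [Real.exp_neg]
      have : (Real.exp 1)⁻¹ ≤ (2.7182818283 : ℝ)⁻¹ := inv_anti₀ (by norm_num) he.le
      have h2 : (2.7182818283 : ℝ)⁻¹ ≤ 0.6931471803 := by norm_num
      linarith
    have h2 : Real.log (Real.exp (-1)) ≤ Real.log (Real.log y) :=
      Real.log_le_log (Real.exp_pos _) (h1.trans hL1)
    rwa [Real.log_exp] at h2
  have hL2pos : 0 < Real.log (Real.log y) := by
    by_contra h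
    push Not at h
    rcases eq_or_lt_of_le h with h0 | hlt
    · rw [h0, Real.log_zero] at hpos; exact lt_irrefl _ hpos
    · have : Real.log (Real.log (Real.log y)) ≤ 0 := by
        rw [← Real.log_neg_eq_log]
        exact Real.log_nonpos (by linarith) (by linarith)
      linarith
  have h1 : Real.log y ≤ Real.log z := Real.log_le_log (by linarith) hyz
  have h2 : Real.log (Real.log y) ≤ Real.log (Real.log z) := Real.log_le_log hL1pos h1
  exact Real.log_le_log hL2pos h2

/-- `log log log x ≤ log x` for `x ≥ 2`. [folklore] -/
private theorem logloglog_le_log {x : ℝ} (hx : 2 ≤ x) :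
    Real.log (Real.log (Real.log x)) ≤ Real.log x := by
  have hl2 := Real.log_two_gt_d9
  have hL1 : Real.log 2 ≤ Real.log x := Real.log_le_log (by norm_num) hx
  have hL1pos : 0 < Real.log x := by linarith
  have hL2 : Real.log (Real.log x) ≤ Real.log x - 1 := Real.log_le_sub_one_of_pos hL1pos
  rcases lt_trichotomy (Real.log (Real.log x)) 0 with hneg | hzero | hpos
  · have h1 : Real.log (Real.log (Real.log x)) = Real.log (-Real.log (Real.log x)) := by
      rw [Real.log_neg_eq_log]
    have h2 : Real.log (-Real.log (Real.log x)) ≤ -Real.log (Real.log x) - 1 :=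
      Real.log_le_sub_one_of_pos (by linarith)
    have h3 : -Real.log (Real.log x) = Real.log ((Real.log x)⁻¹) := by rw [Real.log_inv]
    have h4 : Real.log ((Real.log x)⁻¹) ≤ (Real.log x)⁻¹ - 1 :=
      Real.log_le_sub_one_of_pos (inv_pos.mpr hL1pos)
    have h5 : (Real.log x)⁻¹ ≤ (Real.log 2)⁻¹ := inv_anti₀ (by linarith) hL1
    have h6 : (Real.log 2)⁻¹ < 2 := by
      rw [inv_eq_one_div, div_lt_iff₀ (by linarith)]; linarith
    linarith
  · rw [hzero, Real.log_zero]; linarith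
  · have h3 : Real.log (Real.log (Real.log x)) ≤ Real.log (Real.log x) - 1 :=
      Real.log_le_sub_one_of_pos hpos
    linarith

/-! ### Prop. 10.6 ⟹ Prop. 10.2 (second display) -/

/-- The four rows `(𝔢, λ) ∈ {(4,12), (2,3), (−1,1/2), (0,1)}` of (eq:refinedcondbound), as the bound of
Prop. 10.6 at `N_S = N` (even, `≥ 2`), are each dominated by the second display of Prop. 10.2.
[cite: VonkanelMatschke2023, §10.4 (proof of Prop. 10.2 from Prop. 10.6)] -/
private theorem row_le_second {N : ℕ} (hN : 2 ≤ N) (h2 : 2 ∣ N) {e : ℤ} {lam : ℝ}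
    (he : (e = 4 ∧ lam = 12) ∨ (e = 2 ∧ lam = 3) ∨ (e = -1 ∧ lam = 1 / 2) ∨ (e = 0 ∧ lam = 1)) :
    lam / 5 * (N : ℝ) * Real.log ((2 : ℝ) ^ e * N) +
      3 * lam / 40 * (N : ℝ) * Real.log (Real.log (Real.log ((2 : ℝ) ^ e * N))) +
      2 * lam / 15 * (N : ℝ) + 28 ≤
    12 / 5 * (N : ℝ) * Real.log N +
      9 / 10 * (N : ℝ) * Real.log (Real.log (Real.log (16 * (N : ℝ)))) + 8.26 * (N : ℝ) + 28 := by
  have hl2 := Real.log_two_lt_d9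
  have hl2' := Real.log_two_gt_d9
  have hN' : (2 : ℝ) ≤ N := by exact_mod_cast hN
  have hN0 : (0 : ℝ) < N := by linarith
  have hlogN : 0 ≤ Real.log (N : ℝ) := Real.log_nonneg (by linarith)
  have hNlogN : 0 ≤ (N : ℝ) * Real.log (N : ℝ) := mul_nonneg hN0.le hlogN
  have hT : 0 ≤ Real.log (Real.log (Real.log (16 * (N : ℝ)))) := logloglog_nonneg_of_le (by linarith)
  have hNl2 : (N : ℝ) * Real.log 2 ≤ (N : ℝ) * 0.6931471808 := mul_le_mul_of_nonneg_left hl2.le hN0.le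
  -- generic comparison of the triple-log terms
  have key : ∀ {y : ℝ}, (y = 1 ∨ 2 ≤ y) → y ≤ 16 * N → ∀ {μ : ℝ}, 0 ≤ μ → μ ≤ 9 / 10 →
      μ * (N : ℝ) * Real.log (Real.log (Real.log y)) ≤
        9 / 10 * (N : ℝ) * Real.log (Real.log (Real.log (16 * (N : ℝ)))) := by
    intro y hy hyle μ hμ0 hμ
    by_cases hpos : 0 < Real.log (Real.log (Real.log y))
    · rcases hy with rfl | hy2
      · simp at hpos
      · have hmono := logloglog_mono hy2 hyle hpos
        calc μ * (N : ℝ) * Real.log (Real.log (Real.log y))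
            ≤ μ * (N : ℝ) * Real.log (Real.log (Real.log (16 * (N : ℝ)))) :=
              mul_le_mul_of_nonneg_left hmono (by positivity)
          _ ≤ 9 / 10 * (N : ℝ) * Real.log (Real.log (Real.log (16 * (N : ℝ)))) :=
              mul_le_mul_of_nonneg_right (mul_le_mul_of_nonneg_right hμ hN0.le) hT
    · push Not at hpos
      have h1 : μ * (N : ℝ) * Real.log (Real.log (Real.log y)) ≤ 0 :=
        mul_nonpos_of_nonneg_of_nonpos (by positivity) hpos
      have h2 : 0 ≤ 9 / 10 * (N : ℝ) * Real.log (Real.log (Real.log (16 * (N : ℝ)))) := by positivity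
      linarith
  rcases he with ⟨rfl, rfl⟩ | ⟨rfl, rfl⟩ | ⟨rfl, rfl⟩ | ⟨rfl, rfl⟩
  · -- (4, 12): `2⁴ N_S = 16 N_S`, exact row
    have hy : (2 : ℝ) ^ (4 : ℤ) * N = 16 * N := by norm_num
    rw [hy]
    have hlog : Real.log (16 * (N : ℝ)) = 4 * Real.log 2 + Real.log N := by
      rw [Real.log_mul (by norm_num) hN0.ne', show (16 : ℝ) = 2 ^ 4 by norm_num, Real.log_pow]
      push_cast; ring
    have h1 : (N : ℝ) * Real.log (16 * (N : ℝ)) = 4 * ((N : ℝ) * Real.log 2) + (N : ℝ) * Real.log N := by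
      rw [hlog]; ring
    linarith
  · -- (2, 3): `2² N_S = 4 N_S`
    have hy : (2 : ℝ) ^ (2 : ℤ) * N = 4 * N := by norm_num
    rw [hy]
    have hlog : Real.log (4 * (N : ℝ)) = 2 * Real.log 2 + Real.log N := by
      rw [Real.log_mul (by norm_num) hN0.ne', show (4 : ℝ) = 2 ^ 2 by norm_num, Real.log_pow]
      push_cast; ring
    have h1 : (N : ℝ) * Real.log (4 * (N : ℝ)) = 2 * ((N : ℝ) * Real.log 2) + (N : ℝ) * Real.log N := by
      rw [hlog]; ring
    have hkey := key (y := 4 * (N : ℝ)) (Or.inr (by linarith)) (by linarith)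
      (μ := 3 * 3 / 40) (by norm_num) (by norm_num)
    linarith
  · -- (−1, 1/2): `2⁻¹ N_S = N_S / 2 ∈ ℕ`
    obtain ⟨k, hk⟩ := h2
    have hy : (2 : ℝ) ^ (-1 : ℤ) * N = (k : ℝ) := by
      rw [zpow_neg_one, hk]; push_cast; ring
    rw [hy]
    have hk1 : 1 ≤ k := by omega
    have hky : (k : ℝ) = 1 ∨ (2 : ℝ) ≤ k := by
      rcases eq_or_lt_of_le hk1 with h | h
      · left; exact_mod_cast h.symm
      · right; exact_mod_cast (h : 2 ≤ k)
    have hkN : (k : ℝ) ≤ N := by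
      have : k ≤ N := by omega
      exact_mod_cast this
    have hk0 : (0 : ℝ) < k := by exact_mod_cast hk1
    have hlogk : Real.log (k : ℝ) ≤ Real.log N := Real.log_le_log hk0 hkN
    have h1 : (N : ℝ) * Real.log (k : ℝ) ≤ (N : ℝ) * Real.log N := mul_le_mul_of_nonneg_left hlogk hN0.le
    have hkey := key (y := (k : ℝ)) hky (by linarith) (μ := 3 * (1 / 2) / 40) (by norm_num) (by norm_num)
    linarith
  · -- (0, 1): `2⁰ N_S = N_S`
    have hy : (2 : ℝ) ^ (0 : ℤ) * N = N := by simp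
    rw [hy]
    have hkey := key (y := (N : ℝ)) (Or.inr hN') (by linarith) (μ := 3 * 1 / 40) (by norm_num) (by norm_num)
    linarith

/-- **vKM Prop. 10.6 ⟹ Prop. 10.2, second display** (PROVED deduction, §10.4 "Proof of Proposition
10.2": a solution `(x, y)` of the `S`-unit equation gives a solution `(a, b, c)` of (eq:abc) with
`(x, y) = (a/c, b/c)` and `max(h(x), h(y)) = log max(|a|, |b|, |c|)`, "and thus Proposition 10.6 implies
Proposition 10.2"): from `abc_log_max_le_refined`, every solution satisfies
`max(h(x), h(y)) ≤ (12/5) N_S log N_S + (9/10) N_S log log log(16 N_S) + 8.26 N_S + 28`. (Kernel detail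
the print leaves implicit: `2 ∈ S` by parity, so `N_S` is even and each row of (eq:refinedcondbound) is
dominated by the row `(4, 12)`, whose constants are `(12/5) log 16 + 8/5 = 8.254… ≤ 8.26`. The FIRST
display `(5/2) N_S log N_S + 9 N_S` does not follow this way for the eleven values `N_S ≤ 46` listed in
the module docstring.) The translation `(x, y) ↦ (a, b, c)` is the tree's `MurtyPasten.exists_abc_of_sUnit`.
[cite: VonkanelMatschke2023, Prop. 10.2 (second display) with §10.4 (proof of Prop. 10.2)] -/
theorem sUnitEquation_height_le_two_of_abc_log_max_le_refined (h : abc_log_max_le_refined)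
    (S : Finset ℕ) (hS : ∀ p ∈ S, p.Prime) (x y : ℚ) (hx : IsSUnit S x) (hy : IsSUnit S y)
    (hxy : x + y = 1) :
    max (logHeight₁ x) (logHeight₁ y) ≤
      12 / 5 * (primesProd S : ℝ) * Real.log (primesProd S) +
        9 / 10 * (primesProd S : ℝ) * Real.log (Real.log (Real.log (16 * (primesProd S : ℝ)))) +
        8.26 * (primesProd S : ℝ) + 28 := by
  obtain ⟨A, B, C, hA0, hB0, hC, hABC, hg, hsub, hmax⟩ := MurtyPasten.exists_abc_of_sUnit hx hy hxy
  have hABC0 : (A * B * C).natAbs ≠ 0 := by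
    rw [Int.natAbs_ne_zero]; exact mul_ne_zero (mul_ne_zero hA0 hB0) hC.ne'
  -- `rad(ABC) ∣ N_S`
  have hrad : UniqueFactorizationMonoid.radical (A * B * C).natAbs ∣ primesProd S := by
    rw [Nat.radical_eq_prod_primeFactors, primesProd]
    exact Finset.prod_dvd_prod_of_subset _ _ _ hsub
  -- `2 ∣ ABC` (parity), hence `2 ∈ S`, `N_S` even and `≥ 2`
  have h2dvd : (2 : ℤ) ∣ A * B * C := by
    rcases Int.even_or_odd A with hA | hA
    · exact ((even_iff_two_dvd.mp hA).mul_right B).mul_right C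
    · rcases Int.even_or_odd B with hB | hB
      · exact ((even_iff_two_dvd.mp hB).mul_left A).mul_right C
      · have hCe : Even C := by rw [← hABC]; exact hA.add_odd hB
        exact (even_iff_two_dvd.mp hCe).mul_left (A * B)
  have h2S : 2 ∈ S := by
    apply hsub
    exact Nat.mem_primeFactors.mpr ⟨Nat.prime_two, Int.natAbs_dvd_natAbs.mpr h2dvd, hABC0⟩
  have h2N : 2 ∣ primesProd S := Finset.dvd_prod_of_mem (fun p : ℕ => p) h2S
  have hN2 : 2 ≤ primesProd S := Nat.le_of_dvd (one_le_primesProd hS) h2N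
  have h106 := h S hS A B C hA0 hB0 hC.ne' hABC hg hrad
  have he : (refinedExp (padicValNat 2 (A * B * C).natAbs) = 4 ∧
        refinedCoeff (padicValNat 2 (A * B * C).natAbs) = 12) ∨
      (refinedExp (padicValNat 2 (A * B * C).natAbs) = 2 ∧
        refinedCoeff (padicValNat 2 (A * B * C).natAbs) = 3) ∨
      (refinedExp (padicValNat 2 (A * B * C).natAbs) = -1 ∧
        refinedCoeff (padicValNat 2 (A * B * C).natAbs) = 1 / 2) ∨
      (refinedExp (padicValNat 2 (A * B * C).natAbs) = 0 ∧
        refinedCoeff (padicValNat 2 (A * B * C).natAbs) = 1) := by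
    unfold refinedExp refinedCoeff
    split_ifs <;> norm_num
  have hrow := row_le_second hN2 h2N he
  exact hmax.trans (h106.trans hrow)

/-- **Corollary** (PROVED): Prop. 10.6 gives the second display of Prop. 10.2 in the tree's `abc`-triple
currency: `log c ≤ (12/5) R log R + (9/10) R log log log(16 R) + 8.26 R + 28`, `R = rad(abc)`, for every
`abc` triple (`S` = the primes of `abc`, `x = a/c`, `y = b/c`).
[cite: VonkanelMatschke2023, Prop. 10.2 (second display) with §10.4] -/
theorem abcTriple_log_le_two_of_abc_log_max_le_refined (h : abc_log_max_le_refined) {a b c : ℕ}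
    (ht : IsABCTriple a b c) :
    Real.log c ≤ 12 / 5 * (rad a b c : ℝ) * Real.log (rad a b c : ℕ) +
      9 / 10 * (rad a b c : ℝ) * Real.log (Real.log (Real.log (16 * (rad a b c : ℝ)))) +
      8.26 * (rad a b c : ℝ) + 28 := by
  have htb : IsABCTriple b a c := by
    obtain ⟨ha, hb, habc, hcop⟩ := ht; exact ⟨hb, ha, by omega, hcop.symm⟩
  obtain ⟨hx, hxnum, hxden⟩ := isSUnit_div_of_isABCTriple ht
  obtain ⟨hy, -, -⟩ := isSUnit_div_of_isABCTriple htb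
  have hS : ∀ p ∈ (a * b * c).primeFactors, p.Prime := fun p hp => Nat.prime_of_mem_primeFactors hp
  have hyS : IsSUnit (a * b * c).primeFactors ((b : ℚ) / c) := by
    have : b * a * c = a * b * c := by ring
    rw [this] at hy; exact hy
  obtain ⟨ha, hb, habc, -⟩ := ht
  have hc : (c : ℚ) ≠ 0 := by exact_mod_cast (show c ≠ 0 by omega)
  have hsum : (a : ℚ) / c + (b : ℚ) / c = 1 := by
    rw [← add_div, ← Nat.cast_add, habc, div_self hc]
  have hmain := sUnitEquation_height_le_two_of_abc_log_max_le_refined h _ hS _ _ hx hyS hsum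
  rw [primesProd_primeFactors_eq_rad] at hmain
  have hhx : logHeight₁ ((a : ℚ) / c) = Real.log c := by
    rw [Rat.logHeight₁_eq_log_max, hxnum, hxden, Int.natAbs_natCast, max_eq_right (by omega)]
  calc Real.log c = logHeight₁ ((a : ℚ) / c) := hhx.symm
    _ ≤ max (logHeight₁ ((a : ℚ) / c)) (logHeight₁ ((b : ℚ) / c)) := le_max_left _ _
    _ ≤ _ := hmain

/-! ### `Ω_opt ≤ Ω_sim` from Prop. 10.8 (ii) -/

/-- `max_J Σ log(τ(j)√j) ≥ 0` (the empty `J` is admissible). [cite: VonkanelMatschke2023, §10.5.1 (def:bb*)] -/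
private theorem maxLogTauSum_nonneg (l m : ℕ) : 0 ≤ maxLogTauSum l m := by
  unfold maxLogTauSum
  refine le_trans (le_of_eq ?_) (Finset.le_sup' (fun J : Finset ℕ =>
    ∑ j ∈ J, Real.log ((j.divisors.card : ℝ) * Real.sqrt j)) (b := ∅) ?_)
  · simp
  · simp

/-- `α(N) = min(β, β*) ≥ 0`. [cite: VonkanelMatschke2023, §10.5.1 (def:bb*)] -/
private theorem vkmAlpha_nonneg (N : ℕ) : 0 ≤ vkmAlpha N := by
  have h1 : 0 ≤ vkmBeta N := by
    unfold vkmBeta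
    have := mul_nonneg (Nat.cast_nonneg (newformCount N)) (Real.log_natCast_nonneg (newformCount N))
    have := maxLogTauSum_nonneg (vkmIndexL N) (newformCount N)
    nlinarith
  have h2 : 0 ≤ vkmBetaStar N := by
    unfold vkmBetaStar
    have := mul_nonneg (Nat.cast_nonneg (genusX0 N)) (Real.log_natCast_nonneg (genusX0 N))
    have := maxLogTauSum_nonneg (vkmIndexLStar N) (genusX0 N)
    nlinarith
  exact le_min h1 h2

/-- **(eq:nuineq)-type bound `ν(a_S) ≤ (2/3) a_S`** ("It follows from (eq:nuineq) that `ν(N_E) ≤ (2/3) a_S`",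
§10.3): if `4 ∣ M` and `9 ∣ M` then `ν(M) = M ∏_{p² ∣ M}(1 − p⁻²) ≤ M (1 − 1/4)(1 − 1/9) = (2/3) M`.
[cite: VonkanelMatschke2023, §10.3 (proof of Prop. 10.1, display (eq:nuineq))] -/
theorem condNu_le_two_thirds {M : ℕ} (hM0 : M ≠ 0) (h4 : 4 ∣ M) (h9 : 9 ∣ M) :
    condNu M ≤ 2 / 3 * (M : ℝ) := by
  unfold condNu
  set s : Finset ℕ := M.primeFactors.filter (fun p => p ^ 2 ∣ M) with hs
  have h2s : 2 ∈ s := Finset.mem_filter.mpr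
    ⟨Nat.mem_primeFactors.mpr ⟨Nat.prime_two, dvd_trans (by norm_num) h4, hM0⟩, by simpa using h4⟩
  have h3s : 3 ∈ s.erase 2 := Finset.mem_erase.mpr ⟨by decide, Finset.mem_filter.mpr
    ⟨Nat.mem_primeFactors.mpr ⟨Nat.prime_three, dvd_trans (by norm_num) h9, hM0⟩, by simpa using h9⟩⟩
  have hf01 : ∀ p ∈ s, 0 ≤ 1 - 1 / (p : ℝ) ^ 2 ∧ 1 - 1 / (p : ℝ) ^ 2 ≤ 1 := by
    intro p hp
    have hp2 : (2 : ℝ) ≤ p := by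
      exact_mod_cast (Nat.prime_of_mem_primeFactors (Finset.mem_filter.mp hp).1).two_le
    have h1 : 0 < (p : ℝ) ^ 2 := by positivity
    have h2 : 1 / (p : ℝ) ^ 2 ≤ 1 := by rw [div_le_one h1]; nlinarith
    have h3 : 0 ≤ 1 / (p : ℝ) ^ 2 := by positivity
    exact ⟨by linarith, by linarith⟩
  have hrest : ∏ p ∈ (s.erase 2).erase 3, (1 - 1 / (p : ℝ) ^ 2) ≤ 1 :=
    Finset.prod_le_one
      (fun p hp => (hf01 p (Finset.mem_of_mem_erase (Finset.mem_of_mem_erase hp))).1)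
      (fun p hp => (hf01 p (Finset.mem_of_mem_erase (Finset.mem_of_mem_erase hp))).2)
  have hrest0 : 0 ≤ ∏ p ∈ (s.erase 2).erase 3, (1 - 1 / (p : ℝ) ^ 2) :=
    Finset.prod_nonneg fun p hp => (hf01 p (Finset.mem_of_mem_erase (Finset.mem_of_mem_erase hp))).1
  have hprod : ∏ p ∈ s, (1 - 1 / (p : ℝ) ^ 2) =
      (1 - 1 / (2 : ℝ) ^ 2) * ((1 - 1 / (3 : ℝ) ^ 2) * ∏ p ∈ (s.erase 2).erase 3, (1 - 1 / (p : ℝ) ^ 2)) := by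
    rw [← Finset.mul_prod_erase s _ h2s, ← Finset.mul_prod_erase (s.erase 2) _ h3s]
    push_cast
    ring
  rw [hprod]
  have hM : (0 : ℝ) ≤ M := Nat.cast_nonneg M
  nlinarith [mul_nonneg hM hrest0, mul_le_mul_of_nonneg_left hrest hM]

/-- **vKM `Ω_opt ≤ Ω_sim` ⟸ Prop. 10.8 (ii)** (PROVED deduction; §8.2/§9 state `Ω_opt ≤ Ω_sim`, and §10.3
derives Prop. 10.1 = the `Ω_sim` bound "on combining … with the explicit bound for `h(E)` in terms of
`ν(N_E)` given in Proposition 10.8 (ii)" and "`ν(N_E) ≤ (2/3) a_S`"): with `M = a_S ≥ 1728`, `36 ∣ M`,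
`4α(M) ≤ 4β(M) ≤ (4/9) M log M + (1/6) M log₃ M + (8/27) M` and `2 log(α(M) + κ) + 35 + 4κ ≤ 4 log M + 35
+ 4 · 16.52 ≤ (14/135) M`. [cite: VonkanelMatschke2023, §8.2/§9 (Ω_opt ≤ Ω_sim) with §10.3 (proof of Prop. 10.1)] -/
theorem omegaOpt_le_omegaSim_of_prop_10_8_ii (hii : vonKanelMatschke_prop_10_8_ii) :
    omegaOpt_le_omegaSim := by
  intro S hS a ha haS
  have hM := le_mordellLevel hS a
  have h4 : 4 ∣ mordellLevel S a := by
    rw [mordellLevel_def]; exact Dvd.dvd.mul_right (Dvd.dvd.mul_right (by norm_num) _) _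
  have h9 : 9 ∣ mordellLevel S a := by
    rw [mordellLevel_def]; exact Dvd.dvd.mul_right (Dvd.dvd.mul_right (by norm_num) _) _
  rw [omegaOpt_def]
  unfold omegaSim
  generalize hMdef : mordellLevel S a = M at hM h4 h9 ⊢
  have hM' : (1728 : ℝ) ≤ M := by exact_mod_cast hM
  have hM0 : (0 : ℝ) < M := by linarith
  have hν : condNu M ≤ 2 / 3 * (M : ℝ) := condNu_le_two_thirds (by omega) h4 h9
  have hν0 : 0 ≤ condNu M := condNu_nonneg M
  have hβ := hii M (by omega)
  have hα : vkmAlpha M ≤ vkmBeta M := min_le_left _ _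
  have hα0 : 0 ≤ vkmAlpha M := vkmAlpha_nonneg M
  have hκ := vkmKappa_le
  have hκ0 : 0 < vkmKappa := by
    unfold vkmKappa
    have h1 : 0 ≤ Real.log (163 / Real.pi) := by
      apply Real.log_nonneg
      rw [le_div_iff₀ Real.pi_pos]
      linarith [Real.pi_lt_four]
    linarith [Real.pi_pos]
  have hlogM0 : 0 ≤ Real.log (M : ℝ) := Real.log_nonneg (by linarith)
  have hl3M : 0 ≤ Real.log (Real.log (Real.log (M : ℝ))) := logloglog_nonneg_of_le (by linarith)
  have hl3le : Real.log (Real.log (Real.log (M : ℝ))) ≤ Real.log M := logloglog_le_log (by linarith)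
  have hlogMle : Real.log (M : ℝ) ≤ (M : ℝ) - 1 := Real.log_le_sub_one_of_pos hM0
  -- `4α ≤ (4/9) M log M + (1/6) M log₃ M + (8/27) M`
  have h1 : condNu M * Real.log M ≤ 2 / 3 * (M : ℝ) * Real.log M := mul_le_mul_of_nonneg_right hν hlogM0
  have h2 : condNu M * Real.log (Real.log (Real.log (M : ℝ))) ≤
      2 / 3 * (M : ℝ) * Real.log (Real.log (Real.log (M : ℝ))) := mul_le_mul_of_nonneg_right hν hl3M
  have h4α : 4 * vkmAlpha M ≤ 4 / 9 * (M : ℝ) * Real.log M +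
      1 / 6 * (M : ℝ) * Real.log (Real.log (Real.log (M : ℝ))) + 8 / 27 * (M : ℝ) := by
    linarith
  -- `α + κ ≤ M²`, so `log(α + κ) ≤ 2 log M`
  have h5 : (M : ℝ) * Real.log M ≤ (M : ℝ) * M := mul_le_mul_of_nonneg_left (by linarith) hM0.le
  have h6 : (M : ℝ) * Real.log (Real.log (Real.log (M : ℝ))) ≤ (M : ℝ) * M :=
    mul_le_mul_of_nonneg_left (by linarith) hM0.le
  have hMM : (1728 : ℝ) * M ≤ (M : ℝ) * M := mul_le_mul_of_nonneg_right hM' hM0.le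
  have hsum : vkmAlpha M + vkmKappa ≤ (M : ℝ) ^ 2 := by nlinarith
  have hlogακ : Real.log (vkmAlpha M + vkmKappa) ≤ 2 * Real.log M := by
    have := Real.log_le_log (by linarith) hsum
    rwa [Real.log_pow, Nat.cast_ofNat] at this
  -- `log M ≤ 11 log 2 + (M/1728 − 1)`
  have hlogM : Real.log (M : ℝ) ≤ 11 * Real.log 2 + ((M : ℝ) / 1728 - 1) := by
    have e1 : Real.log (M : ℝ) = Real.log 1728 + Real.log ((M : ℝ) / 1728) := by
      rw [← Real.log_mul (by norm_num) (by positivity)]; congr 1; field_simp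
    have e2 : Real.log ((M : ℝ) / 1728) ≤ (M : ℝ) / 1728 - 1 := Real.log_le_sub_one_of_pos (by positivity)
    have e3 : Real.log (1728 : ℝ) ≤ Real.log 2048 := Real.log_le_log (by norm_num) (by norm_num)
    have e4 : Real.log (2048 : ℝ) = 11 * Real.log 2 := by
      rw [show (2048 : ℝ) = 2 ^ 11 by norm_num, Real.log_pow]; push_cast; ring
    linarith
  have hl2 := Real.log_two_lt_d9
  linarith

/-- **Prop. 10.1 ⟸ Prop. 10.7 + Prop. 10.8 (ii)** (PROVED assembly): the simplified Mordell bound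
`mordell_height_le` follows from the optimized one (`proposition_10_7`) and Prop. 10.8 (ii), through
`Ω_opt ≤ Ω_sim`. [cite: VonkanelMatschke2023, §10.1.1 (Prop. 10.1) with Prop. 10.7 and §10.3] -/
theorem mordell_height_le_of_proposition_10_7_of_prop_10_8_ii (h : proposition_10_7)
    (hii : vonKanelMatschke_prop_10_8_ii) : mordell_height_le :=
  mordell_height_le_of_proposition_10_7 h (omegaOpt_le_omegaSim_of_prop_10_8_ii hii)

end VonKanelMatschke

end Literature.NumberTheory.DiophantineGeometry

end
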